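import Summits.QuantumFields.YangMills.Theorems.UnitScaleTiltSmoothLiftInterpDefs
import Literature.MathematicalPhysics.QuantumFieldTheory.Balaban1983to89.B7TransferAnalyticMean
import Literature.Analysis.Complex.RungeUnits
import Literature.MathematicalPhysics.QuantumFieldTheory.Balaban1983to89.T4SegmentCurvature
import Summits.QuantumFields.BalabanUV.Beta.EriceAxialGaugeWords
import HarnessLib

/-!
# Route `UnitScaleTilt`, crux K1 child «MinimiserStabilityRegPr» (stmt-QuantumFields-19200), stub `stub_smoothLift` (G-K1a-2′) — helper P2a:
# TOOLS FOR THE SMOOTH INTERPOLATION — products of exponentials to second order, conjugation, in-block offsets of shifted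
# sites, and the FIVE-EXPONENTIAL FORM of the interpolation's plaquette variables

Fleet seat `ym-ust-19200-p2` (gen 0).  Elementary matrix analysis and lattice bookkeeping for the interpolation `interp V` of
`UnitScaleTiltSmoothLiftInterpDefs`:
* §3 `‖Π_k e^{X_k} − 1 − Σ_k X_k‖ ≤ e^T − 1 − T` and `‖Π_k e^{X_k} − e^{Σ_k X_k}‖ ≤ 2T²` (`T = Σ_k ‖X_k‖ ≤ 1`);
* §4 `U e^X U* = e^{UXU*}`, `(e^X)* = e^{−X}` on `𝔰𝔲(2)`, `‖UYU*‖ = ‖Y‖`;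
* §5 centred offsets of `x + e_κ` (`+1` inside the block, `−(L−1)` across a face);
* §6 **`coe_plaqHol_interp`**: `interp V (∂p) = e^{s₁B_κ(x)} e^{J₁ s₂B_λ(x+e_κ) J₁*} (faceSec V)(∂p) e^{−J₄ s₃B_κ(x+e_λ) J₄*} e^{−s₄B_λ(x)}`
  (regrouping around the plaquette of the face section, which is a coarse plaquette at an edge and `1` otherwise —
  `BlockAveragingSectionPlaq.plaqHol_faceSec`);
* §8a the scalar bookkeeping of the five exponents in the four exit configurations (abstract module identities).
[cite: King1986, (A.5) p.676; Balaban1987RG1, (0.3)-(0.4) p.252]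
-/

noncomputable section

open NormedSpace
open scoped Matrix.Norms.L2Operator BigOperators

namespace Summit.QuantumFields.YangMills.Theorems.SmoothLiftInterp

open Literature.MathematicalPhysics.QuantumFieldTheory.Balaban1983to89
open MatrixLog T4Continuum AveragingRT BlockAveraging BlockAveragingSection BlockAveragingSectionPlaq

/-! ## §3 Matrix analysis: products of exponentials of small matrices -/

section ExpProducts

variable {𝔸 : Type*} [NormedRing 𝔸] [NormedAlgebra ℂ 𝔸] [NormOneClass 𝔸] [CompleteSpace 𝔸]

/-- `‖Π_k e^{X_k} − 1‖ ≤ e^{Σ_k ‖X_k‖} − 1`. [folklore] -/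
theorem norm_prod_exp_sub_one_le (l : List 𝔸) :
    ‖(l.map exp).prod - 1‖ ≤ Real.exp (l.map (‖·‖)).sum - 1 := by
  induction l with
  | nil => simp
  | cons X l ih =>
    simp only [List.map_cons, List.prod_cons, List.sum_cons]
    have h1 : exp X * (l.map exp).prod - 1 = (exp X - 1) * (l.map exp).prod + ((l.map exp).prod - 1) := by noncomm_ring
    rw [h1, Real.exp_add]
    have hP : ‖(l.map exp).prod‖ ≤ Real.exp (l.map (‖·‖)).sum := by
      have : (l.map exp).prod = ((l.map exp).prod - 1) + 1 := by abel
      rw [this]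
      refine (norm_add_le _ _).trans ?_
      rw [norm_one]; linarith
    have hX := Literature.Analysis.Calculus.norm_exp_sub_one_le X
    have hX0 : 0 ≤ Real.exp ‖X‖ - 1 := by linarith [Real.add_one_le_exp ‖X‖, norm_nonneg X]
    calc ‖(exp X - 1) * (l.map exp).prod + ((l.map exp).prod - 1)‖
        ≤ ‖exp X - 1‖ * ‖(l.map exp).prod‖ + ‖(l.map exp).prod - 1‖ :=
          (norm_add_le _ _).trans (by gcongr; exact norm_mul_le _ _)
      _ ≤ (Real.exp ‖X‖ - 1) * Real.exp (l.map (‖·‖)).sum + (Real.exp (l.map (‖·‖)).sum - 1) := by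
          gcongr
      _ = Real.exp ‖X‖ * Real.exp (l.map (‖·‖)).sum - 1 := by ring

/-- **SECOND-ORDER EXPANSION OF A PRODUCT OF EXPONENTIALS**: `‖Π_k e^{X_k} − 1 − Σ_k X_k‖ ≤ e^{T} − 1 − T`, `T = Σ_k ‖X_k‖`. [folklore] -/
theorem norm_prod_exp_sub_one_sub_sum_le (l : List 𝔸) :
    ‖(l.map exp).prod - 1 - l.sum‖ ≤ Real.exp (l.map (‖·‖)).sum - 1 - (l.map (‖·‖)).sum := by
  induction l with
  | nil => simp
  | cons X l ih =>
    simp only [List.map_cons, List.prod_cons, List.sum_cons]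
    set P' := (l.map exp).prod
    set S' := l.sum
    set T' := (l.map (‖·‖)).sum
    have h1 : exp X * P' - 1 - (X + S') = (P' - 1 - S') + (exp X - 1) * (P' - 1) + (exp X - 1 - X) := by noncomm_ring
    rw [h1]
    have hX1 := Literature.Analysis.Calculus.norm_exp_sub_one_le X
    have hX2 : ‖exp X - 1 - X‖ ≤ Real.exp ‖X‖ - 1 - ‖X‖ := B7TransferAnalyticMean.norm_exp_sub_one_sub_self_le X
    have hP' := norm_prod_exp_sub_one_le l
    have hX0 : 0 ≤ Real.exp ‖X‖ - 1 := by linarith [Real.add_one_le_exp ‖X‖, norm_nonneg X]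
    have hT0 : 0 ≤ Real.exp T' - 1 := by
      have : 0 ≤ T' := List.sum_nonneg (by intro x hx; obtain ⟨y, -, rfl⟩ := List.mem_map.1 hx; exact norm_nonneg _)
      linarith [Real.add_one_le_exp T']
    calc ‖(P' - 1 - S') + (exp X - 1) * (P' - 1) + (exp X - 1 - X)‖
        ≤ ‖P' - 1 - S'‖ + ‖exp X - 1‖ * ‖P' - 1‖ + ‖exp X - 1 - X‖ :=
          (norm_add₃_le).trans (by gcongr; exact norm_mul_le _ _)
      _ ≤ (Real.exp T' - 1 - T') + (Real.exp ‖X‖ - 1) * (Real.exp T' - 1) + (Real.exp ‖X‖ - 1 - ‖X‖) := by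
          gcongr
      _ = Real.exp (‖X‖ + T') - 1 - (‖X‖ + T') := by rw [Real.exp_add]; ring

end ExpProducts

section ExpProducts2

variable {𝔸 : Type*} [NormedRing 𝔸] [NormedAlgebra ℂ 𝔸] [NormOneClass 𝔸] [CompleteSpace 𝔸]

/-- **A PRODUCT OF EXPONENTIALS OF SMALL MATRICES IS THE EXPONENTIAL OF THE SUM TO SECOND ORDER**:
`‖Π_k e^{X_k} − e^{Σ_k X_k}‖ ≤ 2T²` for `T = Σ_k ‖X_k‖ ≤ 1`. [folklore] -/
theorem norm_prod_exp_sub_exp_sum_le (l : List 𝔸) (hT : (l.map (‖·‖)).sum ≤ 1) :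
    ‖(l.map exp).prod - exp l.sum‖ ≤ 2 * (l.map (‖·‖)).sum ^ 2 := by
  set T := (l.map (‖·‖)).sum with hT_def
  have hT0 : 0 ≤ T := List.sum_nonneg (by intro x hx; obtain ⟨y, -, rfl⟩ := List.mem_map.1 hx; exact norm_nonneg _)
  have hS : ‖l.sum‖ ≤ T := Summit.QuantumFields.BalabanUV.Beta.EriceAxialGaugeWords.norm_list_sum_le l
  have h1 := norm_prod_exp_sub_one_sub_sum_le l
  have h2 : ‖exp l.sum - 1 - l.sum‖ ≤ Real.exp T - 1 - T :=
    (B7TransferAnalyticMean.norm_exp_sub_one_sub_self_le _).trans (T4SegmentCurvature.exp_sub_one_sub_mono (norm_nonneg _) hS)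
  have h3 : Real.exp T - 1 - T ≤ T ^ 2 := by
    have := Real.abs_exp_sub_one_sub_id_le (x := T) (by rw [abs_of_nonneg hT0]; exact hT)
    exact (le_abs_self _).trans this
  have hsplit : (l.map exp).prod - exp l.sum = ((l.map exp).prod - 1 - l.sum) - (exp l.sum - 1 - l.sum) := by abel
  rw [hsplit]
  refine (norm_sub_le _ _).trans ?_
  rw [← hT_def] at h1
  linarith

end ExpProducts2

/-! ## §4 Conjugation, and the matrix form of the interpolation's factors -/

section Conj

/-- **`exp` COMMUTES WITH CONJUGATION**: `U e^X U* = e^{U X U*}` for `U ∈ SU(2)`. [folklore] -/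
theorem conj_exp (U : Matrix.specialUnitaryGroup (Fin 2) ℂ) (X : Matrix (Fin 2) (Fin 2) ℂ) :
    (U : Matrix (Fin 2) (Fin 2) ℂ) * exp X * star (U : Matrix (Fin 2) (Fin 2) ℂ) =
      exp ((U : Matrix (Fin 2) (Fin 2) ℂ) * X * star (U : Matrix (Fin 2) (Fin 2) ℂ)) := by
  letI : NormedAlgebra ℚ (Matrix (Fin 2) (Fin 2) ℂ) := NormedAlgebra.restrictScalars ℚ ℂ _
  let u : (Matrix (Fin 2) (Fin 2) ℂ)ˣ :=
    ⟨(U : Matrix (Fin 2) (Fin 2) ℂ), star (U : Matrix (Fin 2) (Fin 2) ℂ),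
      (Matrix.mem_unitaryGroup_iff.1 (Matrix.mem_specialUnitaryGroup_iff.1 U.2).1),
      (Matrix.mem_unitaryGroup_iff'.1 (Matrix.mem_specialUnitaryGroup_iff.1 U.2).1)⟩
  have h := NormedSpace.exp_units_conj u X
  exact h.symm

/-- `(e^X)* = e^{−X}` for `X ∈ 𝔰𝔲(2)`. [folklore] -/
theorem star_exp_of_mem_lie {X : Matrix (Fin 2) (Fin 2) ℂ} (hX : X ∈ (specialUnitaryLogChart (Fin 2)).lie) :
    star (exp X) = exp (-X) := by
  letI : NormedAlgebra ℚ (Matrix (Fin 2) (Fin 2) ℂ) := NormedAlgebra.restrictScalars ℚ ℂ _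
  rw [star_exp, (mem_specialUnitaryLogChart_lie.1 hX).1]

/-- Conjugation is an isometry: `‖U Y U*‖ = ‖Y‖`. [folklore] -/
theorem norm_conj_eq (U : Matrix.specialUnitaryGroup (Fin 2) ℂ) (Y : Matrix (Fin 2) (Fin 2) ℂ) :
    ‖(U : Matrix (Fin 2) (Fin 2) ℂ) * Y * star (U : Matrix (Fin 2) (Fin 2) ℂ)‖ = ‖Y‖ := by
  have hU := (Matrix.mem_specialUnitaryGroup_iff.1 U.2).1
  have h1 : ‖(U : Matrix (Fin 2) (Fin 2) ℂ) * Y * star (U : Matrix (Fin 2) (Fin 2) ℂ)‖ ≤ ‖Y‖ := by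
    calc _ ≤ ‖(U : Matrix (Fin 2) (Fin 2) ℂ) * Y‖ * ‖star (U : Matrix (Fin 2) (Fin 2) ℂ)‖ := norm_mul_le _ _
      _ ≤ (‖(U : Matrix (Fin 2) (Fin 2) ℂ)‖ * ‖Y‖) * ‖star (U : Matrix (Fin 2) (Fin 2) ℂ)‖ := by gcongr; exact norm_mul_le _ _
      _ = ‖Y‖ := by rw [norm_star, UnitaryModel.norm_of_mem_unitaryGroup hU]; ring
  have h2 : ‖Y‖ ≤ ‖(U : Matrix (Fin 2) (Fin 2) ℂ) * Y * star (U : Matrix (Fin 2) (Fin 2) ℂ)‖ := by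
    have hY : Y = star (U : Matrix (Fin 2) (Fin 2) ℂ) * ((U : Matrix (Fin 2) (Fin 2) ℂ) * Y * star (U : Matrix (Fin 2) (Fin 2) ℂ)) *
        (U : Matrix (Fin 2) (Fin 2) ℂ) := by
      have h := Matrix.mem_unitaryGroup_iff'.1 hU
      calc Y = (star (U : Matrix (Fin 2) (Fin 2) ℂ) * (U : Matrix (Fin 2) (Fin 2) ℂ)) * Y *
          (star (U : Matrix (Fin 2) (Fin 2) ℂ) * (U : Matrix (Fin 2) (Fin 2) ℂ)) := by rw [h, one_mul, mul_one]
        _ = _ := by noncomm_ring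
    calc ‖Y‖ = ‖star (U : Matrix (Fin 2) (Fin 2) ℂ) * ((U : Matrix (Fin 2) (Fin 2) ℂ) * Y * star (U : Matrix (Fin 2) (Fin 2) ℂ)) *
          (U : Matrix (Fin 2) (Fin 2) ℂ)‖ := by rw [← hY]
      _ ≤ ‖star (U : Matrix (Fin 2) (Fin 2) ℂ) * ((U : Matrix (Fin 2) (Fin 2) ℂ) * Y * star (U : Matrix (Fin 2) (Fin 2) ℂ))‖ *
          ‖(U : Matrix (Fin 2) (Fin 2) ℂ)‖ := norm_mul_le _ _
      _ ≤ (‖star (U : Matrix (Fin 2) (Fin 2) ℂ)‖ * ‖(U : Matrix (Fin 2) (Fin 2) ℂ) * Y * star (U : Matrix (Fin 2) (Fin 2) ℂ)‖) *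
          ‖(U : Matrix (Fin 2) (Fin 2) ℂ)‖ := by gcongr; exact norm_mul_le _ _
      _ = _ := by rw [norm_star, UnitaryModel.norm_of_mem_unitaryGroup hU]; ring
  exact le_antisymm h1 h2

end Conj

/-! ## §5 Offsets and blocks of shifted sites -/

section Geometry

variable {P : Params} {j : ℕ}

/-- Inside a block a step `+e_κ` raises the `κ`-offset by one. [cite: Balaban1987RG1, (0.3) p.252] -/
theorem coff_shift_self_of_not_exits (hj : j + 1 ≤ P.m + P.K) (x : Site P j) {κ : Fin P.d}
    (h : ¬ ExitsBlock (⟨x, κ⟩ : PBond P j)) : coff (x.shift κ) κ = coff x κ + 1 := by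
  rw [exitsBlock_iff] at h
  change ¬ offset x κ = P.L - 1 at h
  have hlt : offset x κ + 1 < P.L := by have := offset_lt x κ; omega
  unfold coff
  rw [offset_shift_self hj, Nat.mod_eq_of_lt hlt]
  push_cast; ring

/-- Across a face a step `+e_κ` lowers the `κ`-offset by `L − 1` (from `(L−1)/2` to `−(L−1)/2`). [cite: Balaban1987RG1, (0.3) p.252] -/
theorem coff_shift_self_of_exits (hj : j + 1 ≤ P.m + P.K) (x : Site P j) {κ : Fin P.d}
    (h : ExitsBlock (⟨x, κ⟩ : PBond P j)) : coff (x.shift κ) κ = coff x κ - ((P.L : ℝ) - 1) := by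
  rw [exitsBlock_iff] at h
  change offset x κ = P.L - 1 at h
  have hL := P.hL.2
  unfold coff
  rw [offset_shift_self hj, h, Nat.sub_add_cancel (by omega), Nat.mod_self]
  have : ((P.L - 1 : ℕ) : ℝ) = (P.L : ℝ) - 1 := by rw [Nat.cast_sub (by omega)]; simp
  rw [this]; push_cast; ring

/-- Offsets in the other directions are unchanged by `+e_κ`. [cite: Balaban1987RG1, (0.3) p.252] -/
theorem coff_shift_ne (x : Site P j) {κ ν : Fin P.d} (h : ν ≠ κ) : coff (x.shift κ) ν = coff x ν := by
  unfold coff; rw [offset_shift_ne x h]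

/-- On an exiting bond the offset is `(L−1)/2`. [cite: Balaban1987RG1, (0.3) p.252] -/
theorem coff_of_exits (x : Site P j) {κ : Fin P.d} (h : ExitsBlock (⟨x, κ⟩ : PBond P j)) :
    coff x κ = ((P.L : ℝ) - 1) / 2 := by
  rw [exitsBlock_iff] at h
  change offset x κ = P.L - 1 at h
  have hL := P.hL.2
  obtain ⟨k, hk⟩ := P.hL.1
  unfold coff
  rw [h]
  have h1 : ((P.L - 1 : ℕ) : ℝ) = (P.L : ℝ) - 1 := by rw [Nat.cast_sub (by omega)]; simp
  have h2 : (((P.L - 1) / 2 : ℕ) : ℝ) = ((P.L : ℝ) - 1) / 2 := by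
    rw [show (P.L - 1) / 2 = k by omega]
    have : (P.L : ℝ) = 2 * k + 1 := by exact_mod_cast hk
    rw [this]; ring
  rw [h1, h2]; ring

/-- `|n_ν(x)| ≤ (L−1)/2`. [cite: Balaban1987RG1, (0.3) p.252] -/
theorem abs_coff_le (x : Site P j) (ν : Fin P.d) : |coff x ν| ≤ ((P.L : ℝ) - 1) / 2 := by
  have hL := P.hL.2
  obtain ⟨k, hk⟩ := P.hL.1
  have h2 : (((P.L - 1) / 2 : ℕ) : ℝ) = ((P.L : ℝ) - 1) / 2 := by
    rw [show (P.L - 1) / 2 = k by omega]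
    have : (P.L : ℝ) = 2 * k + 1 := by exact_mod_cast hk
    rw [this]; ring
  have h3 : (offset x ν : ℝ) ≤ (P.L : ℝ) - 1 := by
    have := offset_lt x ν
    have : (offset x ν : ℝ) + 1 ≤ P.L := by exact_mod_cast this
    linarith
  have h4 : (0 : ℝ) ≤ offset x ν := Nat.cast_nonneg _
  unfold coff
  rw [h2, abs_le]
  constructor <;> linarith

end Geometry

/-! ## §6 The plaquette variables of the interpolation as products of five exponentials -/

section PlaqProduct

variable {P : Params} {j : ℕ}

/-- Regrouping a plaquette word `(M₁J₁)(M₂J₂)(M₃J₃)⁻¹(M₄J₄)⁻¹` around the plaquette `J₁J₂J₃⁻¹J₄⁻¹` of the `J`'s. [folklore] -/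
theorem regroup {G : Type*} [Group G] (M₁ J₁ M₂ J₂ M₃ J₃ M₄ J₄ : G) :
    (M₁ * J₁) * (M₂ * J₂) * (M₃ * J₃)⁻¹ * (M₄ * J₄)⁻¹ =
      M₁ * (J₁ * M₂ * J₁⁻¹) * (J₁ * J₂ * J₃⁻¹ * J₄⁻¹) * (J₄ * M₃⁻¹ * J₄⁻¹) * M₄⁻¹ := by
  group

/-- **THE PLAQUETTE VARIABLE OF THE INTERPOLATION IS A PRODUCT OF FIVE EXPONENTIALS**: for `p = ⟨x, κ, λ⟩`,
`interp V (∂p) = e^{s₁B_κ(x)} · e^{J₁ s₂B_λ(x+e_κ) J₁*} · (faceSec V)(∂p) · e^{−J₄ s₃B_κ(x+e_λ) J₄*} · e^{−s₄B_λ(x)}` with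
`J₁ = faceSec V ⟨x, κ⟩`, `J₄ = faceSec V ⟨x, λ⟩`, and `(faceSec V)(∂p) = e^{log (faceSec V)(∂p)}` a coarse plaquette variable or `1`
(`BlockAveragingSectionPlaq.plaqHol_faceSec`). [cite: King1986, (A.5) p.676] -/
theorem coe_plaqHol_interp (V : GaugeField P (j+1) (Matrix.specialUnitaryGroup (Fin 2) ℂ)) (p : Plaq P j)
    (hQ : ‖((GaugeField.plaqHol (faceSec V) p : Matrix.specialUnitaryGroup (Fin 2) ℂ) : Matrix (Fin 2) (Fin 2) ℂ) - 1‖ < 1) :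
    ((GaugeField.plaqHol (interp V) p : Matrix.specialUnitaryGroup (Fin 2) ℂ) : Matrix (Fin 2) (Fin 2) ℂ) =
      (([wt ⟨p.src, p.μ⟩ • pot V p.src p.μ,
         ((faceSec V ⟨p.src, p.μ⟩ : Matrix.specialUnitaryGroup (Fin 2) ℂ) : Matrix (Fin 2) (Fin 2) ℂ) *
            (wt ⟨p.src.shift p.μ, p.ν⟩ • pot V (p.src.shift p.μ) p.ν) *
            star ((faceSec V ⟨p.src, p.μ⟩ : Matrix.specialUnitaryGroup (Fin 2) ℂ) : Matrix (Fin 2) (Fin 2) ℂ),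
         mlog ((GaugeField.plaqHol (faceSec V) p : Matrix.specialUnitaryGroup (Fin 2) ℂ) : Matrix (Fin 2) (Fin 2) ℂ),
         -(((faceSec V ⟨p.src, p.ν⟩ : Matrix.specialUnitaryGroup (Fin 2) ℂ) : Matrix (Fin 2) (Fin 2) ℂ) *
            (wt ⟨p.src.shift p.ν, p.μ⟩ • pot V (p.src.shift p.ν) p.μ) *
            star ((faceSec V ⟨p.src, p.ν⟩ : Matrix.specialUnitaryGroup (Fin 2) ℂ) : Matrix (Fin 2) (Fin 2) ℂ)),
         -(wt ⟨p.src, p.ν⟩ • pot V p.src p.ν)] : List (Matrix (Fin 2) (Fin 2) ℂ)).map exp).prod := by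
  letI : NormedAlgebra ℚ (Matrix (Fin 2) (Fin 2) ℂ) := NormedAlgebra.restrictScalars ℚ ℂ _
  -- regroup in the group
  have hgrp : GaugeField.plaqHol (interp V) p =
      modelFactor V ⟨p.src, p.μ⟩ *
        (faceSec V ⟨p.src, p.μ⟩ * modelFactor V ⟨p.src.shift p.μ, p.ν⟩ * (faceSec V ⟨p.src, p.μ⟩)⁻¹) *
        GaugeField.plaqHol (faceSec V) p *
        (faceSec V ⟨p.src, p.ν⟩ * (modelFactor V ⟨p.src.shift p.ν, p.μ⟩)⁻¹ * (faceSec V ⟨p.src, p.ν⟩)⁻¹) *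
        (modelFactor V ⟨p.src, p.ν⟩)⁻¹ := by
    unfold GaugeField.plaqHol
    simp only [interp_apply]
    exact regroup _ _ _ _ _ _ _ _
  rw [hgrp]
  simp only [List.map_cons, List.map_nil, List.prod_cons, List.prod_nil, mul_one, Submonoid.coe_mul, coe_inv_su2,
    coe_modelFactor]
  -- the five factors
  have h2 : ((faceSec V ⟨p.src, p.μ⟩ : Matrix.specialUnitaryGroup (Fin 2) ℂ) : Matrix (Fin 2) (Fin 2) ℂ) *
      exp (wt ⟨p.src.shift p.μ, p.ν⟩ • pot V (p.src.shift p.μ) p.ν) *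
      star ((faceSec V ⟨p.src, p.μ⟩ : Matrix.specialUnitaryGroup (Fin 2) ℂ) : Matrix (Fin 2) (Fin 2) ℂ) =
      exp (((faceSec V ⟨p.src, p.μ⟩ : Matrix.specialUnitaryGroup (Fin 2) ℂ) : Matrix (Fin 2) (Fin 2) ℂ) *
        (wt ⟨p.src.shift p.μ, p.ν⟩ • pot V (p.src.shift p.μ) p.ν) *
        star ((faceSec V ⟨p.src, p.μ⟩ : Matrix.specialUnitaryGroup (Fin 2) ℂ) : Matrix (Fin 2) (Fin 2) ℂ)) :=
    conj_exp _ _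
  have h3 : ((GaugeField.plaqHol (faceSec V) p : Matrix.specialUnitaryGroup (Fin 2) ℂ) : Matrix (Fin 2) (Fin 2) ℂ) =
      exp (mlog ((GaugeField.plaqHol (faceSec V) p : Matrix.specialUnitaryGroup (Fin 2) ℂ) : Matrix (Fin 2) (Fin 2) ℂ)) :=
    (exp_mlog hQ).symm
  have h4 : ((faceSec V ⟨p.src, p.ν⟩ : Matrix.specialUnitaryGroup (Fin 2) ℂ) : Matrix (Fin 2) (Fin 2) ℂ) *
      star (exp (wt ⟨p.src.shift p.ν, p.μ⟩ • pot V (p.src.shift p.ν) p.μ)) *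
      star ((faceSec V ⟨p.src, p.ν⟩ : Matrix.specialUnitaryGroup (Fin 2) ℂ) : Matrix (Fin 2) (Fin 2) ℂ) =
      exp (-(((faceSec V ⟨p.src, p.ν⟩ : Matrix.specialUnitaryGroup (Fin 2) ℂ) : Matrix (Fin 2) (Fin 2) ℂ) *
        (wt ⟨p.src.shift p.ν, p.μ⟩ • pot V (p.src.shift p.ν) p.μ) *
        star ((faceSec V ⟨p.src, p.ν⟩ : Matrix.specialUnitaryGroup (Fin 2) ℂ) : Matrix (Fin 2) (Fin 2) ℂ))) := by
    rw [star_exp_of_mem_lie (wt_smul_pot_mem_lie V ⟨p.src.shift p.ν, p.μ⟩), conj_exp, mul_neg, neg_mul]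
  have h5 : star (exp (wt ⟨p.src, p.ν⟩ • pot V p.src p.ν)) = exp (-(wt ⟨p.src, p.ν⟩ • pot V p.src p.ν)) :=
    star_exp_of_mem_lie (wt_smul_pot_mem_lie V ⟨p.src, p.ν⟩)
  rw [h2, ← h3, h4, h5]
  simp only [mul_assoc]

end PlaqProduct

/-! ## §8 The structure of the fine plaquettes: `interp V (∂p) = exp(F_{κλ}(y)/L² + O(|F|² + |∇F|))` -/

section Algebra

variable {M : Type*} [AddCommGroup M] [Module ℝ M]

/-- Bookkeeping of the five exponents, EDGE configuration. [folklore] -/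
theorem alg_edge (s r : ℝ) (A B c E₂ E₃ : M) :
    s • A + s • (B - r • c + E₂) + c + -(s • (A + r • c + E₃)) + -(s • B) = (1 - 2 * s * r) • c + (s • E₂ - s • E₃) := by
  module

/-- Bookkeeping of the five exponents, FACE-`κ` configuration. [folklore] -/
theorem alg_face₁ (s r t : ℝ) (A B c E₂ : M) :
    s • A + (B - r • c + E₂) + 0 + -(s • (A - t • c)) + -B = (s * t - r) • c + E₂ := by
  module

/-- Bookkeeping of the five exponents, FACE-`λ` configuration. [folklore] -/
theorem alg_face₂ (s r t : ℝ) (A B c E₃ : M) :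
    A + s • (B + t • c) + 0 + -(A + r • c + E₃) + -(s • B) = (s * t - r) • c + -E₃ := by
  module

/-- Bookkeeping of the five exponents, INTERIOR configuration. [folklore] -/
theorem alg_int (t : ℝ) (A B c : M) :
    A + (B + t • c) + 0 + -(A - t • c) + -B = (2 * t) • c + 0 := by
  module

end Algebra

end Summit.QuantumFields.YangMills.Theorems.SmoothLiftInterp

end
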